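import Literature.NumberTheory.LFunctions.WeilTwoPrimeOddMarginHBase
import Literature.NumberTheory.LFunctions.WeilTwoPrimeCellsT120
import Literature.NumberTheory.LFunctions.WeilTwoPrimeCertificate
import HarnessLib

/-!
# Two-prime odd-margin certificate H: the certificate `weilCert23H : WeilCert23`

`weilCert23H` = base `weilCert23HBase` (`a₀ = 1733/2500`, `N = 255`, `T = 120`) + dyadic exponent `j = 5` + table tolerance `pnu = 64` + the cells `weilTwoPrimeCellsT120` + support `b = 1733/2500` + the claimed scaled moment table `weilCert23HNu`. [cite: Yoshida1992, §6, Thm 1 p. 310] Data only.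
-/

noncomputable section

namespace Literature.NumberTheory.LFunctions

/-- **The two-prime odd-sector margin certificate H** (`a₀ = b = 1733/2500`, `N = 255`, `T = 120`,
margin `κ − κ' ≥ 1/10000000000`). [folklore] -/
def weilCert23H : WeilCert23 := ⟨weilCert23HBase, 5, 64, weilTwoPrimeCellsT120, 1733/2500, weilCert23HNu⟩

/-- The base of `weilCert23H` is `weilCert23HBase` (definitional). [folklore] -/
theorem weilCert23H_base : weilCert23H.base = weilCert23HBase := rfl

/-- The table of `weilCert23H` is `weilCert23HNu` (definitional). [folklore] -/
theorem weilCert23H_nuTab : weilCert23H.nuTab = weilCert23HNu := rfl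

/-- The cells of `weilCert23H` are `weilTwoPrimeCellsT120` (definitional). [folklore] -/
theorem weilCert23H_cells : weilCert23H.cells = weilTwoPrimeCellsT120 := rfl

end Literature.NumberTheory.LFunctions
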